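import Literature.Topology.FourManifolds.ConnectedSum
import HarnessLib

/-!
# Boundary connected sums of smooth manifolds with boundary (relational form)

The *boundary connected sum* `X ♮ Y` of two manifolds with boundary (Juhász, *Differential and
Low-Dimensional Topology* (2023), Def. 1.47; Gompf–Stipsicz, *4-Manifolds and Kirby Calculus*
(1999), §1.1) is to manifolds with boundary what the connected sum `M # N`
(`Literature.Topology.FourManifolds.ConnectedSum`) is to closed manifolds: choose embeddings
`e₁ : (H, D) ↪ (X, ∂X)`, `e₂ : (H, D) ↪ (Y, ∂Y)` of the closed half-disc `H = Dⁿ ∩ ℝⁿ₊` meeting the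
boundary in the flat face `D = Dⁿ⁻¹`, remove the centres `e₁ 0`, `e₂ 0`, and identify `e₁ (t • v)`
with `e₂ ((1 - t) • v)` for every unit vector `v` of the closed half space and every `t ∈ (0, 1)`
(Juhász, Def. 1.47, verbatim up to notation). Then `∂(X ♮ Y) = ∂X # ∂Y`.

This file provides the vocabulary, in the relational style of `Literature.Topology.FourManifolds.IsConnectedSum`
(Kervaire–Milnor's description of `#` as an open gluing of the punctured pieces), needed one rung
below Matveyev's cork decomposition theorem (`Literature/Topology/FourManifolds/CorkTwist.lean`,
`Literature.Topology.FourManifolds.corkDecomposition`; Matveyev, *A decomposition of smooth simply-connected h-cobordant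
4-manifolds*, J. Differential Geom. 44 (1996), proof of part 2 of the Theorem, p. 3 and fig. 2):
there the second part (`W₁ ≅ W₂`) is deduced from the first and from the "Fact"
`W₁ ∪_Σ W₁ ≅ S⁴ ≅ W₁ ∪_Σ W₂` by rewriting `M₁ = (M ∪_Σ W₁) # (W₁ ∪_Σ W₂)` as
`(M ♮ W₁) ∪_{Σ # Σ} (W₁ ♮ W₂)`, the new corks being the boundary connected sums `W₁ ♮ W₂ ≅ W₂ ♮ W₁`.

## Main definitions (real)

* `Literature.EuclideanHalfSpace.dilate t v`: the dilation `t • v` of the closed half space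
  `EuclideanHalfSpace n = {x | 0 ≤ x 0}` by `t ≥ 0` (junk value `0` for `t < 0`, never used).
* `Literature.boundaryConnectedSumRel h₁ h₂`: Juhász's gluing relation on the punctured pieces
  `X ∖ {h₁ 0}`, `Y ∖ {h₂ 0}`: `h₁ (t • v) ∼ h₂ ((1 - t) • v)` for `‖v‖ = 1`, `0 < t < 1`.
* `Literature.IsBoundaryConnectedSum n IP IX IY X Y P`: `P` is *a* boundary connected sum `X ♮ Y`: for some
  smooth embeddings `h₁ : EuclideanHalfSpace n → X`, `h₂ : EuclideanHalfSpace n → Y` of the closed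
  half space *with open range* (equivalently, for embeddings of full dimension: mapping the flat
  face into the boundary — Juhász's embeddings of pairs `(H, D) ↪ (X, ∂X)`), `P` is the open gluing
  (`Literature.Topology.FourManifolds.IsOpenGluing`) of `X ∖ {h₁ 0}` and `Y ∖ {h₂ 0}` along `boundaryConnectedSumRel h₁ h₂`.
  Argument order as for `IsConnectedSum`: dimension and models `n IP IX IY`, then types `X Y P`.

## Main statements

Proved: `boundaryConnectedSumRel_swap`, `IsBoundaryConnectedSum.symm`, `isBoundaryConnectedSum_comm`
(`X ♮ Y = Y ♮ X` as relations on the same `P`), `isBoundaryConnectedSum_iff`,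
`IsBoundaryConnectedSum.nonempty`, and the elementary API of `dilate`.

Named facts (statements only, D-0014), all for genuine manifolds with boundary modelled on
`𝓡∂ n`:
* `Literature.Topology.FourManifolds.exists_isOpenGluing_boundaryConnectedSumRel`: **existence** — for boundary-adapted half-discs
  `h₁`, `h₂` in (Hausdorff, second countable) smooth `n`-manifolds with boundary `X`, `Y` there is a
  smooth `n`-manifold with boundary `P` which is the open gluing of the punctured pieces along
  `boundaryConnectedSumRel h₁ h₂` (Juhász Def. 1.47; the smooth structure on an identification
  space along a diffeomorphism of open subsets: Kosinski, *Differential Manifolds*, VI.1;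
  Hirsch, *Differential Topology*, Ch. 8 §2).
* `Literature.Topology.FourManifolds.compactSpace_of_isOpenGluing_boundaryConnectedSumRel`: `X ♮ Y` is compact if `X`, `Y` are.
* `Literature.Topology.FourManifolds.contractibleSpace_of_isOpenGluing_boundaryConnectedSumRel`: `X ♮ Y` is contractible if `X`,
  `Y` are (it is homotopy equivalent to the wedge `X ∨ Y`); this is how Matveyev's new corks
  `W₁ ♮ W₂` are again contractible.

## Design notes

* As for `IsConnectedSum`, no orientation data are recorded, so `P` is not unique up to
  diffeomorphism in general; consumers needing canonicity keep the half-discs `h₁`, `h₂` explicit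
  and use the relation-level statements (`IsOpenGluing … (boundaryConnectedSumRel h₁ h₂)`), for
  which uniqueness up to diffeomorphism is the tree's proved `Literature.Topology.FourManifolds.IsOpenGluing.nonempty_diffeomorph`
  (`GluingUniqueness.lean`). This is the form in which Matveyev's connected-sum manipulation is
  chirality-safe: all four boundary connected sums of his fig. 2 are taken along one half-disc in
  each of `W₁`, `W₂`, `M`.
* The condition `IsOpen (range hᵢ)` replaces Juhász's "embedding of pairs `(H, D) ↪ (X, ∂X)`": for
  a smooth embedding of the `n`-dimensional closed half space into an `n`-manifold with boundary the
  two are equivalent (invariance of domain), and openness is what constructions use. Without it a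
  closed half-ball inside the interior of `X` would be admitted as `h₁` (for such `h₁` no open
  gluing along `boundaryConnectedSumRel h₁ h₂` exists, so `IsBoundaryConnectedSum` would not
  change, but the relation-level facts below would become false).
* Mathlib status: no connected sum, boundary connected sum or gluing of manifolds
  (`rg -i 'connected sum' Mathlib`: nothing); `EuclideanHalfSpace n` has `Zero`, `convex`, path
  connectedness, and the model `𝓡∂ n`, but no dilation API.

## References

* A. Juhász, *Differential and Low-Dimensional Topology*, LMS Student Texts 104, CUP (2023),
  Def. 1.44 (connected sum), Def. 1.47 (boundary connected sum, `∂(W₁ ♮ W₂) = ∂W₁ # ∂W₂`), p. 19.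
* M. Kervaire, J. Milnor, *Groups of homotopy spheres I*, Ann. of Math. 77 (1963), §2.
* A. Kosinski, *Differential Manifolds* (1993), Ch. VI §1.
* M. Hirsch, *Differential Topology*, GTM 33 (1976), Ch. 8 §2 (gluing manifolds together).
* R. Matveyev, *A decomposition of smooth simply-connected h-cobordant 4-manifolds*,
  J. Differential Geom. 44 (1996), 571–582 (arXiv:dg-ga/9505001), p. 3 and fig. 2.
-/

open scoped Manifold ContDiff Topology
open Set Function

noncomputable section

namespace Literature.Topology.FourManifolds

universe u

/-- Local notation: `𝔼 n` is the model Euclidean space `EuclideanSpace ℝ (Fin n)`. -/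
local notation "𝔼 " n:arg => EuclideanSpace ℝ (Fin n)

/-! ### Dilations of the closed half space -/

section Dilate

variable {n : ℕ} [NeZero n]

/-- **Dilation of the closed half space.** `dilate t v = t • v` for `t ≥ 0`, as a point of the
closed half space `EuclideanHalfSpace n = {x : ℝⁿ | 0 ≤ x 0}` (which is a convex cone). For
`t < 0` the junk value `dilate t v = 0` is returned (the definition uses `max t 0`); it is never
used: the boundary connected sum relation only dilates by `t ∈ (0, 1)`. [cite: Juhasz2023, Def. 1.47] -/
def EuclideanHalfSpace.dilate (t : ℝ) (v : EuclideanHalfSpace n) : EuclideanHalfSpace n :=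
  ⟨max t 0 • v.val, by
    have hv : 0 ≤ v.val 0 := v.2
    have h : (max t 0 • v.val) 0 = max t 0 * v.val 0 := rfl
    rw [h]
    exact mul_nonneg (le_max_right t 0) hv⟩

/-- The underlying vector of `dilate t v` is `max t 0 • v` (definitional unfolding). [cite: Juhasz2023, Def. 1.47] -/
theorem EuclideanHalfSpace.val_dilate (t : ℝ) (v : EuclideanHalfSpace n) :
    (EuclideanHalfSpace.dilate t v).val = max t 0 • v.val :=
  rfl

/-- The underlying vector of `dilate t v` is `t • v` for `t ≥ 0`. [cite: Juhasz2023, Def. 1.47] -/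
@[simp] theorem EuclideanHalfSpace.val_dilate_of_nonneg {t : ℝ} (ht : 0 ≤ t)
    (v : EuclideanHalfSpace n) : (EuclideanHalfSpace.dilate t v).val = t • v.val := by
  rw [EuclideanHalfSpace.val_dilate, max_eq_left ht]

/-- Dilating by `1` is the identity. [cite: Juhasz2023, Def. 1.47] -/
@[simp] theorem EuclideanHalfSpace.dilate_one (v : EuclideanHalfSpace n) :
    EuclideanHalfSpace.dilate 1 v = v :=
  EuclideanHalfSpace.ext _ _ (by rw [EuclideanHalfSpace.val_dilate_of_nonneg zero_le_one, one_smul])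

/-- Dilating by `0` gives the origin of the half space. [cite: Juhasz2023, Def. 1.47] -/
@[simp] theorem EuclideanHalfSpace.dilate_zero (v : EuclideanHalfSpace n) :
    EuclideanHalfSpace.dilate 0 v = 0 :=
  EuclideanHalfSpace.ext _ _ (by rw [EuclideanHalfSpace.val_dilate_of_nonneg le_rfl, zero_smul]; rfl)

/-- Dilations compose multiplicatively (for nonnegative factors). [cite: Juhasz2023, Def. 1.47] -/
theorem EuclideanHalfSpace.dilate_dilate {s t : ℝ} (hs : 0 ≤ s) (ht : 0 ≤ t)
    (v : EuclideanHalfSpace n) :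
    EuclideanHalfSpace.dilate s (EuclideanHalfSpace.dilate t v) =
      EuclideanHalfSpace.dilate (s * t) v :=
  EuclideanHalfSpace.ext _ _ (by
    rw [EuclideanHalfSpace.val_dilate_of_nonneg hs, EuclideanHalfSpace.val_dilate_of_nonneg ht,
      EuclideanHalfSpace.val_dilate_of_nonneg (mul_nonneg hs ht), smul_smul])

/-- The norm of `dilate t v` is `t` for a unit vector `v` and `t ≥ 0`: the dilates `dilate t v`,
`0 < t < 1`, of the unit vectors sweep out the punctured open unit half-disc. [cite: Juhasz2023, Def. 1.47] -/
theorem EuclideanHalfSpace.norm_val_dilate {t : ℝ} (ht : 0 ≤ t) {v : EuclideanHalfSpace n}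
    (hv : ‖v.val‖ = 1) : ‖(EuclideanHalfSpace.dilate t v).val‖ = t := by
  rw [EuclideanHalfSpace.val_dilate_of_nonneg ht, norm_smul, hv, mul_one, Real.norm_of_nonneg ht]

/-- A dilate `dilate t v` of a unit vector by `t > 0` is not the origin. [cite: Juhasz2023, Def. 1.47] -/
theorem EuclideanHalfSpace.dilate_ne_zero {t : ℝ} (ht : 0 < t) {v : EuclideanHalfSpace n}
    (hv : ‖v.val‖ = 1) : EuclideanHalfSpace.dilate t v ≠ 0 := by
  intro h
  have h0 : (0 : EuclideanHalfSpace n).val = 0 := rfl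
  have h' : ‖(EuclideanHalfSpace.dilate t v).val‖ = 0 := by rw [h, h0, norm_zero]
  rw [EuclideanHalfSpace.norm_val_dilate ht.le hv] at h'
  exact ht.ne' h'

/-- Dilation by `t ≥ 0` multiplies the height `x 0` above the flat face `{x 0 = 0}` of the half
space (the face along which half-discs meet the boundary) by `t`; in particular it preserves the
flat face and, for `t > 0`, its complement. [cite: Juhasz2023, Def. 1.47] -/
theorem EuclideanHalfSpace.val_dilate_apply_zero {t : ℝ} (ht : 0 ≤ t) (v : EuclideanHalfSpace n) :
    (EuclideanHalfSpace.dilate t v).val 0 = t * v.val 0 := by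
  rw [EuclideanHalfSpace.val_dilate_of_nonneg ht]
  rfl

end Dilate

/-! ### The boundary connected sum relation -/

section Rel

variable {n : ℕ} [NeZero n] {X Y : Type*}

/-- **Juhász's boundary connected sum relation** (the half-space analogue of Kervaire–Milnor's
`Literature.Topology.FourManifolds.connectedSumRel`). Given maps ("half-disc embeddings") `h₁ : EuclideanHalfSpace n → X`,
`h₂ : EuclideanHalfSpace n → Y` of the closed half space, the point `a` of `X ∖ {h₁ 0}` is related
to the point `b` of `Y ∖ {h₂ 0}` iff `a = h₁ (t • v)` and `b = h₂ ((1 - t) • v)` for some unit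
vector `v` of the closed half space and some `t ∈ (0, 1)`: "identifying `e₁ (t v)` with
`e₂ ((1 - t) v)` for every `v ∈ Sⁿ ∩ ℝⁿ⁺¹₊` and `t ∈ (0, 1)`". [cite: Juhasz2023, Def. 1.47] -/
def boundaryConnectedSumRel (h₁ : EuclideanHalfSpace n → X) (h₂ : EuclideanHalfSpace n → Y)
    (a : ↥({h₁ 0}ᶜ : Set X)) (b : ↥({h₂ 0}ᶜ : Set Y)) : Prop :=
  ∃ (v : EuclideanHalfSpace n) (t : ℝ),
    ‖v.val‖ = 1 ∧ t ∈ Ioo (0 : ℝ) 1 ∧ (a : X) = h₁ (EuclideanHalfSpace.dilate t v) ∧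
      (b : Y) = h₂ (EuclideanHalfSpace.dilate (1 - t) v)

/-- The boundary connected sum relation is symmetric under exchanging the two half-discs:
substitute `t ↦ 1 - t` (as for `connectedSumRel_swap`). [cite: Juhasz2023, Def. 1.47] -/
theorem boundaryConnectedSumRel_swap (h₁ : EuclideanHalfSpace n → X)
    (h₂ : EuclideanHalfSpace n → Y) :
    Function.swap (boundaryConnectedSumRel h₁ h₂) = boundaryConnectedSumRel h₂ h₁ := by
  funext b a
  apply propext
  constructor
  · rintro ⟨v, t, hv, ht, ha, hb⟩
    refine ⟨v, 1 - t, hv, ⟨by linarith [ht.2], by linarith [ht.1]⟩, hb, ?_⟩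
    rwa [sub_sub_cancel]
  · rintro ⟨v, t, hv, ht, hb, ha⟩
    refine ⟨v, 1 - t, hv, ⟨by linarith [ht.2], by linarith [ht.1]⟩, ha, ?_⟩
    rwa [sub_sub_cancel]

/-- Related points lie on the punctured *open unit* half-discs: if `a ∼ b` then `a = h₁ w` with
`0 < ‖w‖ < 1` (and symmetrically for `b`, by `boundaryConnectedSumRel_swap`). [cite: Juhasz2023, Def. 1.47] -/
theorem boundaryConnectedSumRel.exists_eq_apply {h₁ : EuclideanHalfSpace n → X}
    {h₂ : EuclideanHalfSpace n → Y} {a : ↥({h₁ 0}ᶜ : Set X)} {b : ↥({h₂ 0}ᶜ : Set Y)}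
    (h : boundaryConnectedSumRel h₁ h₂ a b) :
    ∃ w : EuclideanHalfSpace n, 0 < ‖w.val‖ ∧ ‖w.val‖ < 1 ∧ (a : X) = h₁ w := by
  obtain ⟨v, t, hv, ht, ha, -⟩ := h
  refine ⟨EuclideanHalfSpace.dilate t v, ?_, ?_, ha⟩
  · rw [EuclideanHalfSpace.norm_val_dilate ht.1.le hv]; exact ht.1
  · rw [EuclideanHalfSpace.norm_val_dilate ht.1.le hv]; exact ht.2

end Rel

/-! ### Boundary connected sums -/

section BoundaryConnectedSum

variable {EP HP : Type*} [NormedAddCommGroup EP] [NormedSpace ℝ EP] [TopologicalSpace HP]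

/-- **Boundary connected sum** (relational form). `IsBoundaryConnectedSum n IP IX IY X Y P` says
that the manifold `P` (modelled on `IP`) is a boundary connected sum `X ♮ Y` of the manifolds with
boundary `X`, `Y`: there are smooth embeddings `h₁ : EuclideanHalfSpace n → X`,
`h₂ : EuclideanHalfSpace n → Y` of the closed `n`-dimensional half space with open ranges
("half-discs `(H, D) ↪ (X, ∂X)`, `(H, D) ↪ (Y, ∂Y)`") such that `P` is the open gluing of
`X ∖ {h₁ 0}` and `Y ∖ {h₂ 0}` along Juhász's relation `h₁ (t • v) ∼ h₂ ((1 - t) • v)`, `‖v‖ = 1`,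
`0 < t < 1`. Argument order: dimension `n`, models `IP IX IY`, types `X Y P`; `X`, `Y` are
Hausdorff so that the punctured pieces are open. No connectedness (of `X`, `Y` or their
boundaries) or orientation data are recorded, so `P` is in general not unique up to
diffeomorphism; and, as for `IsOpenGluing`, no `IsManifold` hypothesis is imposed — consumers add
what they need. A *definition* (predicate), not a closed named fact: its universal closure is
false (`IsBoundaryConnectedSum.nonempty`). [cite: Juhasz2023, Def. 1.47] -/
def IsBoundaryConnectedSum (n : ℕ) [NeZero n] (IP : ModelWithCorners ℝ EP HP)
    {EX HX : Type*} [NormedAddCommGroup EX] [NormedSpace ℝ EX] [TopologicalSpace HX]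
    (IX : ModelWithCorners ℝ EX HX)
    {EY HY : Type*} [NormedAddCommGroup EY] [NormedSpace ℝ EY] [TopologicalSpace HY]
    (IY : ModelWithCorners ℝ EY HY)
    (X Y P : Type*) [TopologicalSpace X] [T2Space X] [ChartedSpace HX X]
    [TopologicalSpace Y] [T2Space Y] [ChartedSpace HY Y] [TopologicalSpace P] [ChartedSpace HP P] :
    Prop :=
  ∃ (h₁ : EuclideanHalfSpace n → X) (h₂ : EuclideanHalfSpace n → Y),
    Manifold.IsSmoothEmbedding (𝓡∂ n) IX ∞ h₁ ∧ IsOpen (range h₁) ∧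
    Manifold.IsSmoothEmbedding (𝓡∂ n) IY ∞ h₂ ∧ IsOpen (range h₂) ∧
    IsOpenGluing IX IY IP (A := puncture h₁) (B := puncture h₂) (P := P)
      (boundaryConnectedSumRel h₁ h₂)

variable {n : ℕ} [NeZero n] {IP : ModelWithCorners ℝ EP HP}
  {EX HX : Type*} [NormedAddCommGroup EX] [NormedSpace ℝ EX] [TopologicalSpace HX]
  {IX : ModelWithCorners ℝ EX HX}
  {EY HY : Type*} [NormedAddCommGroup EY] [NormedSpace ℝ EY] [TopologicalSpace HY]
  {IY : ModelWithCorners ℝ EY HY}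
  {X Y P : Type*} [TopologicalSpace X] [T2Space X] [ChartedSpace HX X]
  [TopologicalSpace Y] [T2Space Y] [ChartedSpace HY Y] [TopologicalSpace P] [ChartedSpace HP P]

/-- Unfolding of `IsBoundaryConnectedSum`. [cite: Juhasz2023, Def. 1.47] -/
theorem isBoundaryConnectedSum_iff : IsBoundaryConnectedSum n IP IX IY X Y P ↔
    ∃ (h₁ : EuclideanHalfSpace n → X) (h₂ : EuclideanHalfSpace n → Y),
      Manifold.IsSmoothEmbedding (𝓡∂ n) IX ∞ h₁ ∧ IsOpen (range h₁) ∧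
      Manifold.IsSmoothEmbedding (𝓡∂ n) IY ∞ h₂ ∧ IsOpen (range h₂) ∧
      IsOpenGluing IX IY IP (A := puncture h₁) (B := puncture h₂) (P := P)
        (boundaryConnectedSumRel h₁ h₂) :=
  Iff.rfl

/-- The boundary connected sum is symmetric: `P` is a boundary connected sum `X ♮ Y` iff it is a
boundary connected sum `Y ♮ X` (swap the half-discs and substitute `t ↦ 1 - t`). This is the
relational content of "`W₁ ♮ W₂ ≅ W₂ ♮ W₁`" (Matveyev 1996, p. 3). [cite: Juhasz2023, Def. 1.47] -/
theorem IsBoundaryConnectedSum.symm (h : IsBoundaryConnectedSum n IP IX IY X Y P) :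
    IsBoundaryConnectedSum n IP IY IX Y X P := by
  obtain ⟨h₁, h₂, e₁, o₁, e₂, o₂, hG⟩ := h
  refine ⟨h₂, h₁, e₂, o₂, e₁, o₁, ?_⟩
  rw [← boundaryConnectedSumRel_swap]
  exact hG.symm

/-- The boundary connected sum is commutative as a relation: `X ♮ Y = P ↔ Y ♮ X = P`. [cite: Juhasz2023, Def. 1.47] -/
theorem isBoundaryConnectedSum_comm :
    IsBoundaryConnectedSum n IP IX IY X Y P ↔ IsBoundaryConnectedSum n IP IY IX Y X P :=
  ⟨IsBoundaryConnectedSum.symm, IsBoundaryConnectedSum.symm⟩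

/-- Constructor: an open gluing along `boundaryConnectedSumRel h₁ h₂` for boundary-adapted
half-discs `h₁`, `h₂` is a boundary connected sum. [cite: Juhasz2023, Def. 1.47] -/
theorem IsBoundaryConnectedSum.of_isOpenGluing {h₁ : EuclideanHalfSpace n → X}
    {h₂ : EuclideanHalfSpace n → Y} (e₁ : Manifold.IsSmoothEmbedding (𝓡∂ n) IX ∞ h₁)
    (o₁ : IsOpen (range h₁)) (e₂ : Manifold.IsSmoothEmbedding (𝓡∂ n) IY ∞ h₂)
    (o₂ : IsOpen (range h₂))
    (hG : IsOpenGluing IX IY IP (A := puncture h₁) (B := puncture h₂) (P := P)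
      (boundaryConnectedSumRel h₁ h₂)) :
    IsBoundaryConnectedSum n IP IX IY X Y P :=
  ⟨h₁, h₂, e₁, o₁, e₂, o₂, hG⟩

/-- A boundary connected sum is nonempty: the punctured piece `X ∖ {h₁ 0}` contains `h₁ v` for
any `v ≠ 0`, e.g. a unit vector on the flat face (`n ≥ 1`). [cite: Juhasz2023, Def. 1.47] -/
theorem IsBoundaryConnectedSum.nonempty (h : IsBoundaryConnectedSum n IP IX IY X Y P) :
    Nonempty P := by
  obtain ⟨h₁, h₂, e₁, -, -, -, jA, jB, -⟩ := h
  -- the point `EuclideanSpace.single 0 1` lies in the closed half space and is nonzero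
  let v : EuclideanHalfSpace n := ⟨EuclideanSpace.single (0 : Fin n) (1 : ℝ), by simp⟩
  have hv : v ≠ 0 := by
    intro h
    have h' : (EuclideanSpace.single (0 : Fin n) (1 : ℝ) : 𝔼 n) 0 = (0 : 𝔼 n) 0 := by
      rw [show (EuclideanSpace.single (0 : Fin n) (1 : ℝ) : 𝔼 n) = v.val from rfl, h]; rfl
    simp at h'
  exact ⟨jA ⟨h₁ v, fun h => hv (e₁.isEmbedding.injective h)⟩⟩

end BoundaryConnectedSum

/-! ### Existence and topology of boundary connected sums (named facts, D-0014) -/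

section Facts

/-- **Existence of boundary connected sums** (relation-level form). Let `X`, `Y` be smooth
`n`-manifolds with boundary (Hausdorff, second countable, modelled on `𝓡∂ n`) and let
`h₁ : EuclideanHalfSpace n → X`, `h₂ : EuclideanHalfSpace n → Y` be smooth embeddings of the closed
half space with open ranges (half-discs meeting the boundary in their flat faces). Then there is a
smooth `n`-manifold with boundary `P` (Hausdorff, second countable) which is the open gluing of
`X ∖ {h₁ 0}` and `Y ∖ {h₂ 0}` along `h₁ (t • v) ∼ h₂ ((1 - t) • v)` — the identification space of
Juhász's Def. 1.47, with the smooth structure for which both projections are diffeomorphisms onto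
open subsets (the gluing map `h₂ ∘ (t • v ↦ (1 - t) • v) ∘ h₁⁻¹` is a diffeomorphism between open
subsets of the pieces with closed graph, so the identification space is a Hausdorff manifold;
Kosinski, *Differential Manifolds*, VI.1; Hirsch, *Differential Topology*, Ch. 8 §2). In
particular `IsBoundaryConnectedSum n (𝓡∂ n) (𝓡∂ n) (𝓡∂ n) X Y P`
(`IsBoundaryConnectedSum.of_isOpenGluing`). Not yet constructible in the tree: the pushout
construction `Literature.Topology.FourManifolds.SmoothGlueData.Glued` (`GluingConstruction.lean`) is for boundaryless pieces.
[cite: Juhasz2023, Def. 1.47] -/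
def exists_isOpenGluing_boundaryConnectedSumRel : Prop :=
  ∀ (n : ℕ) [NeZero n] (X Y : Type u) [TopologicalSpace X] [T2Space X] [SecondCountableTopology X]
    [ChartedSpace (EuclideanHalfSpace n) X] [IsManifold (𝓡∂ n) ∞ X]
    [TopologicalSpace Y] [T2Space Y] [SecondCountableTopology Y]
    [ChartedSpace (EuclideanHalfSpace n) Y] [IsManifold (𝓡∂ n) ∞ Y]
    (h₁ : EuclideanHalfSpace n → X) (h₂ : EuclideanHalfSpace n → Y),
    Manifold.IsSmoothEmbedding (𝓡∂ n) (𝓡∂ n) ∞ h₁ → IsOpen (range h₁) →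
    Manifold.IsSmoothEmbedding (𝓡∂ n) (𝓡∂ n) ∞ h₂ → IsOpen (range h₂) →
      ∃ (P : Type u) (_ : TopologicalSpace P) (_ : T2Space P) (_ : SecondCountableTopology P)
        (_ : ChartedSpace (EuclideanHalfSpace n) P) (_ : IsManifold (𝓡∂ n) ∞ P),
        IsOpenGluing (𝓡∂ n) (𝓡∂ n) (𝓡∂ n) (A := puncture h₁) (B := puncture h₂) (P := P)
          (boundaryConnectedSumRel h₁ h₂)

/-- **A boundary connected sum of compact manifolds is compact**: if `P` is an open gluing of
`X ∖ {h₁ 0}` and `Y ∖ {h₂ 0}` along `boundaryConnectedSumRel h₁ h₂` for half-discs `h₁`, `h₂` with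
open ranges, and `X`, `Y` are compact, then `P` is compact — it is the union of the images of the
compact sets `X ∖ h₁ {‖v‖ < 1/2}` and `Y ∖ h₂ {‖v‖ < 1/2}`, since a point `h₁ (t • v)` with
`t < 1/2` is identified with `h₂ ((1 - t) • v)`, `1 - t > 1/2` (as for `IsConnectedSum.compactSpace`;
Kosinski, *Differential Manifolds*, VI.1). Stated, as the other facts of this file, for pieces
modelled on `𝓡∂ n` (no smoothness of the atlases is needed for this statement). [cite: Juhasz2023, Def. 1.47] -/
def compactSpace_of_isOpenGluing_boundaryConnectedSumRel : Prop :=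
  ∀ (n : ℕ) [NeZero n] (X Y P : Type u) [TopologicalSpace X] [T2Space X]
    [ChartedSpace (EuclideanHalfSpace n) X] [CompactSpace X]
    [TopologicalSpace Y] [T2Space Y] [ChartedSpace (EuclideanHalfSpace n) Y] [CompactSpace Y]
    [TopologicalSpace P] [ChartedSpace (EuclideanHalfSpace n) P]
    (h₁ : EuclideanHalfSpace n → X) (h₂ : EuclideanHalfSpace n → Y),
    Manifold.IsSmoothEmbedding (𝓡∂ n) (𝓡∂ n) ∞ h₁ → IsOpen (range h₁) →
    Manifold.IsSmoothEmbedding (𝓡∂ n) (𝓡∂ n) ∞ h₂ → IsOpen (range h₂) →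
    IsOpenGluing (𝓡∂ n) (𝓡∂ n) (𝓡∂ n) (A := puncture h₁) (B := puncture h₂) (P := P)
      (boundaryConnectedSumRel h₁ h₂) → CompactSpace P

/-- **A boundary connected sum of contractible manifolds is contractible.** If `P` is an open
gluing of `X ∖ {h₁ 0}` and `Y ∖ {h₂ 0}` along `boundaryConnectedSumRel h₁ h₂` for half-discs `h₁`,
`h₂` with open ranges in smooth `n`-manifolds with boundary `X`, `Y` (all three Hausdorff, second
countable, modelled on `𝓡∂ n`), and `X`, `Y` are contractible, then `P` is contractible:
`X ♮ Y` deformation retracts onto the union of `X ∖ h₁ {‖v‖ < 1/2} ≅ X`, `Y ∖ h₂ {‖v‖ < 1/2} ≅ Y`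
and the collar `{‖v‖ = 1/2} ≅ Dⁿ⁻¹` between them, so `X ♮ Y ≃ X ∨ Y` (a homotopy pushout of
contractible spaces along a contractible space). This is the (implicit) reason why Matveyev's new
corks `W₁ ♮ W₂` (1996, p. 3, fig. 2) are again contractible. [folklore] -/
def contractibleSpace_of_isOpenGluing_boundaryConnectedSumRel : Prop :=
  ∀ (n : ℕ) [NeZero n] (X Y P : Type u) [TopologicalSpace X] [T2Space X]
    [SecondCountableTopology X] [ChartedSpace (EuclideanHalfSpace n) X] [IsManifold (𝓡∂ n) ∞ X]
    [TopologicalSpace Y] [T2Space Y] [SecondCountableTopology Y]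
    [ChartedSpace (EuclideanHalfSpace n) Y] [IsManifold (𝓡∂ n) ∞ Y]
    [TopologicalSpace P] [T2Space P] [SecondCountableTopology P]
    [ChartedSpace (EuclideanHalfSpace n) P] [IsManifold (𝓡∂ n) ∞ P]
    (h₁ : EuclideanHalfSpace n → X) (h₂ : EuclideanHalfSpace n → Y),
    ContractibleSpace X → ContractibleSpace Y →
    Manifold.IsSmoothEmbedding (𝓡∂ n) (𝓡∂ n) ∞ h₁ → IsOpen (range h₁) →
    Manifold.IsSmoothEmbedding (𝓡∂ n) (𝓡∂ n) ∞ h₂ → IsOpen (range h₂) →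
    IsOpenGluing (𝓡∂ n) (𝓡∂ n) (𝓡∂ n) (A := puncture h₁) (B := puncture h₂) (P := P)
      (boundaryConnectedSumRel h₁ h₂) → ContractibleSpace P

variable {n : ℕ} [NeZero n]

/-- Corollary of the two topological facts in the form consumed by the cork decomposition: a
boundary connected sum (along explicit half-discs) of compact contractible smooth `n`-manifolds
with boundary is compact and contractible — Matveyev's new corks `W₁ ♮ W₂`. [folklore] -/
theorem compactSpace_and_contractibleSpace_of_isOpenGluing_boundaryConnectedSumRel
    (hc : compactSpace_of_isOpenGluing_boundaryConnectedSumRel.{u})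
    (hk : contractibleSpace_of_isOpenGluing_boundaryConnectedSumRel.{u})
    {X Y P : Type u} [TopologicalSpace X] [T2Space X]
    [SecondCountableTopology X] [ChartedSpace (EuclideanHalfSpace n) X] [IsManifold (𝓡∂ n) ∞ X]
    [CompactSpace X] [TopologicalSpace Y] [T2Space Y] [SecondCountableTopology Y]
    [ChartedSpace (EuclideanHalfSpace n) Y] [IsManifold (𝓡∂ n) ∞ Y] [CompactSpace Y]
    [TopologicalSpace P] [T2Space P] [SecondCountableTopology P]
    [ChartedSpace (EuclideanHalfSpace n) P] [IsManifold (𝓡∂ n) ∞ P]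
    (hX : ContractibleSpace X) (hY : ContractibleSpace Y)
    {h₁ : EuclideanHalfSpace n → X} {h₂ : EuclideanHalfSpace n → Y}
    (e₁ : Manifold.IsSmoothEmbedding (𝓡∂ n) (𝓡∂ n) ∞ h₁) (o₁ : IsOpen (range h₁))
    (e₂ : Manifold.IsSmoothEmbedding (𝓡∂ n) (𝓡∂ n) ∞ h₂) (o₂ : IsOpen (range h₂))
    (hG : IsOpenGluing (𝓡∂ n) (𝓡∂ n) (𝓡∂ n) (A := puncture h₁) (B := puncture h₂) (P := P)
      (boundaryConnectedSumRel h₁ h₂)) :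
    CompactSpace P ∧ ContractibleSpace P :=
  ⟨hc n X Y P h₁ h₂ e₁ o₁ e₂ o₂ hG, hk n X Y P h₁ h₂ hX hY e₁ o₁ e₂ o₂ hG⟩

/-- Existence in the `IsBoundaryConnectedSum` form: for boundary-adapted half-discs `h₁`, `h₂` in
smooth `n`-manifolds with boundary there is a smooth `n`-manifold with boundary which is a boundary
connected sum `X ♮ Y` (from `exists_isOpenGluing_boundaryConnectedSumRel`). [cite: Juhasz2023, Def. 1.47] -/
theorem exists_isBoundaryConnectedSum_of_halfDiscs
    (hex : exists_isOpenGluing_boundaryConnectedSumRel.{u})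
    {X Y : Type u} [TopologicalSpace X] [T2Space X] [SecondCountableTopology X]
    [ChartedSpace (EuclideanHalfSpace n) X] [IsManifold (𝓡∂ n) ∞ X]
    [TopologicalSpace Y] [T2Space Y] [SecondCountableTopology Y]
    [ChartedSpace (EuclideanHalfSpace n) Y] [IsManifold (𝓡∂ n) ∞ Y]
    {h₁ : EuclideanHalfSpace n → X} {h₂ : EuclideanHalfSpace n → Y}
    (e₁ : Manifold.IsSmoothEmbedding (𝓡∂ n) (𝓡∂ n) ∞ h₁) (o₁ : IsOpen (range h₁))
    (e₂ : Manifold.IsSmoothEmbedding (𝓡∂ n) (𝓡∂ n) ∞ h₂) (o₂ : IsOpen (range h₂)) :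
    ∃ (P : Type u) (_ : TopologicalSpace P) (_ : T2Space P) (_ : SecondCountableTopology P)
      (_ : ChartedSpace (EuclideanHalfSpace n) P) (_ : IsManifold (𝓡∂ n) ∞ P),
      IsBoundaryConnectedSum n (𝓡∂ n) (𝓡∂ n) (𝓡∂ n) X Y P := by
  obtain ⟨P, _, _, _, _, _, hG⟩ := hex n X Y h₁ h₂ e₁ o₁ e₂ o₂
  exact ⟨P, ‹_›, ‹_›, ‹_›, ‹_›, ‹_›, IsBoundaryConnectedSum.of_isOpenGluing e₁ o₁ e₂ o₂ hG⟩

end Facts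

end Literature.Topology.FourManifolds

end
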